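import Literature.AlgebraicGeometry.Frobenioids.ArchimedeanModelType
import Literature.AlgebraicGeometry.Frobenioids.Thm36iModelTypeBridge
import Literature.AlgebraicGeometry.Frobenioids.Thm36SubProofs
import HarnessLib

/-!
# Frobenioids II, Theorem 3.6 (i) "model type … rational function monoid ≅ (Φ^fld)^Λ" at `Λ = ℚ`:
# the closer MODULO the rational-function-monoid structure (proof-only)

Mochizuki, *The geometry of Frobenioids II: poly-Frobenioids*, Kyushu J. Math. **62** (2008)
401–460, §3, Theorem 3.6 (i), kurims text p. 36 ll. 34–35 [cite: MochizukiFrdII2008, Thm 3.6 (i) p.36].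

PROOF-ONLY file (abc-iut cell, layer L1, row M13-c3 of HOME/staging/L1/L1-t6/g3/M13-c3-DESIGN.md; piece
P4 minus its by-name input P3; seat abc-iut-L1-t6).  For THE perfection `C^ℚ = C^pf` of the archimedean
Frobenioid (`Thm36Sub.pfStr π hF`, Frobenioid by `Thm36Sub.pf_isFrobenioid`), the typed clause
`Thm36i_istrModel (pfStr π hF) (ModelFrobenioid.toElem Φ^pf B Div_B)` holds for EVERY model datum `(B, Div_B)`
over `Φ^pf` that carries a rational function monoid structure of `C^pf` ([FrdI] Prop. 4.4 (ii),
`PreFrobenioid.RationalFunctionMonoidStr`): inputs `Thm36Sub.istrAll_Q_holds` ("`(C^ℚ)^istr = C^ℚ`"),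
`Thm36Sub.pf_isOfModelType` (`C^pf` of model type) and the bridge `thm36i_istrModel_of_isOfModelType`
([FrdI] Thm. 5.2 (iv)).  The remaining input for the printed datum `B = (Φ^fld)^ℚ := (Φ^fld)^pf`,
`Div_B = divPerfection (fieldMonoidToGp (Φ π) π)` (`PerfectionGroupification.lean`) is exactly the structure
`RationalFunctionMonoidStr (pfStr π hF) (pf_isFrobenioid π hF) (perfectionFunctor (fieldMonoid (Φ π) π)) (divPerfection …)`
(pieces P2/P3, seat abc-iut-w5-d246): `istrModel_Q_of_str` applied to it IS the P4 closer `istrModel_Q_holds`.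
Classical; no side taken on [IUTchIII] Cor. 3.12; no definitions.
-/

noncomputable section

namespace Literature.AlgebraicGeometry.Frobenioids

open CategoryTheory

namespace ArchFrd

namespace Thm36Sub

universe v u

variable {D : Type u} [Category.{v} D] (π : D ⥤ D0)

/-- **Thm. 3.6 (i) "model type" at `Λ = ℚ`, modulo the rational-function-monoid structure**: for THE
perfection `C^pf` and any model datum `(B, Div_B)` over `Φ^pf` with a rational function monoid structure `R`
of `C^pf`, `(C^pf)^istr ≌` the model Frobenioid of `(Φ^pf, B, Div_B)` compatibly with the structure functors.
[cite: MochizukiFrdII2008, Thm 3.6 (i) p.36] -/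
theorem istrModel_Q_of_str (hF : PreFrobenioid.IsFrobenioid (C.toElem π))
    {B : Dᵒᵖ ⥤ CommMonCat.{0}} {DivB : B ⟶ monoidGp (PreFrobenioid.Perfection.ops hF).monFunctor}
    (R : PreFrobenioid.RationalFunctionMonoidStr (pfStr π hF) (pf_isFrobenioid π hF) B DivB) :
    Thm36i_istrModel (pfStr π hF)
      (ModelFrobenioid.toElem (PreFrobenioid.Perfection.ops hF).monFunctor B DivB) :=
  thm36i_istrModel_of_isOfModelType (pf_isFrobenioid π hF) (istrAll_Q_holds π hF (fun h => by cases h))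
    (pf_isOfModelType π hF) R

end Thm36Sub

end ArchFrd

end Literature.AlgebraicGeometry.Frobenioids

end
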